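import Mathlib.Data.Multiset.Bind
import Mathlib.Data.Multiset.Count
import Mathlib.Data.Multiset.Lattice
import Mathlib.Data.List.Chain
import Mathlib.Data.Finset.Range
import Mathlib.Logic.Function.Basic
import Literature.Computability.MetaComplexity.ResLin
import Literature.Computability.MetaComplexity.ResLinProofs
import HarnessLib

/-!
# Reversible resolution over parities `RevRes(⊕)` — blackboard derivations

`RevRes(⊕)` [Alekseev–Gaevoy, ITCS 2026, §4.2] is the fragment of resolution over parities `Res(⊕)`
(`Literature.Computability.MetaComplexity.IsResLinRefutation`) obtained by dropping the `Copy` rule: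
a derivation is a sequence of *blackboard configurations* — finite multisets of linear clauses —
each obtained from the previous one by replacing the premises of ONE rule application by its
conclusions [AG, Defs 8–9], the rules being the strongly sound, reversible ones [AG, Defs 12–13]:

* Reversible Cut `A ∨ (f = 1), A ∨ (f = 0) ⊢ A` and its reverse (we call the reverse `split`);
* Excluded Middle `⊢ (f = 0) ∨ (f = 1)` and its reverse;
* Reversible Equivalence `A ⊢ B` when `¬A` and `¬B` define the same affine subspace.

A refutation of a CNF `φ` starts from a multiset of clauses of `φ` (any multiplicities) and ends in a
configuration containing the empty clause [AG, Def 11]; its LENGTH is the number of configurations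
[AG, Def 9; by Remark 10 length and size differ by a polynomial factor only and all of AG's theorems
preserve both].

## Contents

* `RevResLinStep L L'` — one rule application; `IsRevResLinRefutation φ π`.
* `falsifiedCount` and the CONSERVATION LAW `RevResLinStep.falsifiedCount_eq` [AG, Def 12, Remark 19]:
  every rule preserves, for every assignment, the number of falsified clause occurrences on the
  board (this is what fails for `Copy`, Remark 15); soundness `not_satisfiable_of_isRevResLinRefutation`.
* Completeness `exists_isRevResLinRefutation` (RevRes(⊕) is a blackboard proof system in the sense
  of [AG, Def 11]): split a falsified initial clause down to a point clause for each of the `2^V`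
  assignments of the `V = numVars φ` variables, then merge the point clauses by cuts.
* Depth-stamped derivations `RevResLinDStep`, `IsRevResLinDRefutation`, `revResLinDDepth` (each clause
  occurrence carries the length of the longest premise-chain below it — the blackboard reading of the
  depth of the associated parity DAG [Alekseev–Gaevoy, ECCC TR26-007, Defs 2.2–2.3]) and the
  projection `IsRevResLinDRefutation.map_fst` forgetting stamps.
* The named fact `exists_isRevResLinRefutation_php_of_isResLinRefutation` [AG, Thm 26 with Cor 27]:
  a Res(⊕) refutation of `PHP^{n+1}_n` with `s` lines yields a RevRes(⊕) refutation of length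
  `poly(s, n)`. AG's Question 3 (is PHP hard for RevRes(⊕)?) is OPEN and is recorded, not asserted.

## Design notes

* Linear clauses are the `Finset`-based `LinClause` of `ResLin.lean`; `A ∨ (f = b)` is
  `insert (f, b) A`. When `(f, b) ∈ A` already, the degenerate instances of cut/split are still
  strongly sound (checked in `falsifiedCount_eq`), so no side condition is imposed.
* Reversible Equivalence is taken SEMANTICALLY (`∀ σ, A.eval σ = B.eval σ`). For clauses whose
  negations are consistent systems this is literally "the same affine subspace"; between tautologies
  (empty "subspace") it is a harmless extension: tautological occurrences are never falsified, and a
  lower bound for this slightly more liberal system implies the same bound for AG's.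
* What is NOT here: the catalytic system `u-wRes(⊕)`, terminals (`RevResT(⊕)`), the intersection
  theorem itself (Thm 21/26 — only its PHP corollary is recorded, as a named fact), parity decision
  DAGs as a datatype.
-/

namespace Literature.Computability.MetaComplexity

open _root_.Computability Complexity

/-! ### Semantics of `insert`, unions and single-variable literals (`LinClause.eval_empty` is in `ResLinProofs`) -/

/-- `(A ∨ l)` is true iff `l` is or `A` is. [Itsykson–Sokolov 2020, §2] [cite: ItsyksonSokolov2020, §2] -/
theorem LinClause.eval_insert (σ : ℕ → Bool) (l : LinLit) (A : LinClause) :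
    LinClause.eval σ (insert l A) = (l.eval σ || A.eval σ) := by
  apply Bool.eq_iff_iff.2
  simp [LinClause.eval]

/-- `(A ∨ B)` is true iff `A` is or `B` is. [Itsykson–Sokolov 2020, §2] [cite: ItsyksonSokolov2020, §2] -/
theorem LinClause.eval_union (σ : ℕ → Bool) (A B : LinClause) :
    LinClause.eval σ (A ∪ B) = (A.eval σ || B.eval σ) := by
  apply Bool.eq_iff_iff.2
  simp only [LinClause.eval, Finset.mem_union, decide_eq_true_eq, Bool.or_eq_true]
  constructor
  · rintro ⟨l, hl | hl, h⟩
    · exact Or.inl ⟨l, hl, h⟩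
    · exact Or.inr ⟨l, hl, h⟩
  · rintro (⟨l, hl, h⟩ | ⟨l, hl, h⟩)
    · exact ⟨l, Or.inl hl, h⟩
    · exact ⟨l, Or.inr hl, h⟩

/-- The two equations `f = 1` and `f = 0` have opposite values. [Itsykson–Sokolov 2020, §2]
[cite: ItsyksonSokolov2020, §2] -/
theorem LinLit.eval_true_eq_not (σ : ℕ → Bool) (f : Finset ℕ) :
    LinLit.eval σ (f, true) = !LinLit.eval σ (f, false) := by
  rcases Nat.mod_two_eq_zero_or_one ((f.filter fun i => σ i = true).card) with h | h <;>
    simp [LinLit.eval, h]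

/-- The excluded-middle clause `(f = 0) ∨ (f = 1)` is a tautology. [Alekseev–Gaevoy 2026, §4.2]
[cite: AlekseevGaevoy2026, §4.2] -/
theorem LinClause.eval_em (σ : ℕ → Bool) (f : Finset ℕ) :
    LinClause.eval σ ({(f, false), (f, true)} : LinClause) = true := by
  rw [LinClause.eval_insert]
  have h := LinLit.eval_true_eq_not σ f
  have h2 : LinClause.eval σ ({(f, true)} : LinClause) = LinLit.eval σ (f, true) := by
    rw [← Finset.insert_empty, LinClause.eval_insert, LinClause.eval_empty, Bool.or_false]
  rw [h2, h]
  cases LinLit.eval σ (f, false) <;> rfl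

/-- The single-variable equation `xᵢ = b` has value `σ i == b`. [Itsykson–Sokolov 2020, §2]
[cite: ItsyksonSokolov2020, §2] -/
theorem LinLit.eval_singleton (σ : ℕ → Bool) (i : ℕ) (b : Bool) :
    LinLit.eval σ (({i} : Finset ℕ), b) = (σ i == b) := by
  simpa [Literal.toLinLit, Literal.eval] using eval_toLinLit (i, b) σ

/-! ### The rules of RevRes(⊕) and refutations -/

/-- One step of a `RevRes(⊕)` blackboard derivation [Alekseev–Gaevoy 2026, §4.2 with Defs 9, 13]:
the premises of one rule application are REPLACED by its conclusions inside the configuration.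
`cut`: `A ∨ (f=0), A ∨ (f=1) ⊢ A` (Reversible Cut); `split`: its reverse; `emIntro`/`emElim`:
Excluded Middle `⊢ (f=0) ∨ (f=1)` and its reverse; `equiv`: Reversible Equivalence, taken
semantically (see the module docstring). There is NO `Copy` rule — adding it gives Res(⊕).
[cite: AlekseevGaevoy2026, §4.2 (rules of RevRes(⊕)), Def 9, Def 13] -/
inductive RevResLinStep : Multiset LinClause → Multiset LinClause → Prop
  /-- Reversible Cut: `A ∨ (f = 0), A ∨ (f = 1) ⊢ A`. -/
  | cut (L : Multiset LinClause) (A : LinClause) (f : Finset ℕ) :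
      RevResLinStep (insert (f, false) A ::ₘ insert (f, true) A ::ₘ L) (A ::ₘ L)
  /-- Reversed cut ("split"): `A ⊢ A ∨ (f = 0), A ∨ (f = 1)`. -/
  | split (L : Multiset LinClause) (A : LinClause) (f : Finset ℕ) :
      RevResLinStep (A ::ₘ L) (insert (f, false) A ::ₘ insert (f, true) A ::ₘ L)
  /-- Excluded Middle: `⊢ (f = 0) ∨ (f = 1)`. -/
  | emIntro (L : Multiset LinClause) (f : Finset ℕ) :
      RevResLinStep L (({(f, false), (f, true)} : LinClause) ::ₘ L)
  /-- Reversed Excluded Middle: `(f = 0) ∨ (f = 1) ⊢`. -/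
  | emElim (L : Multiset LinClause) (f : Finset ℕ) :
      RevResLinStep (({(f, false), (f, true)} : LinClause) ::ₘ L) L
  /-- Reversible Equivalence: `A ⊢ B` when `A` and `B` are falsified by the same assignments. -/
  | equiv (L : Multiset LinClause) (A B : LinClause) (h : ∀ σ : ℕ → Bool, A.eval σ = B.eval σ) :
      RevResLinStep (A ::ₘ L) (B ::ₘ L)

/-- `π` is a `RevRes(⊕)` refutation of the CNF `φ` [Alekseev–Gaevoy 2026, Defs 9 and 11 with §4.2]:
a nonempty sequence of configurations, the first consisting of (translations of) clauses of `φ`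
with arbitrary multiplicities, consecutive ones related by one rule application, the last
containing the empty clause. Its length `π.length` is AG's length (number of configurations).
[cite: AlekseevGaevoy2026, Def 9, Def 11, §4.2] -/
def IsRevResLinRefutation (φ : CNF ℕ) (π : List (Multiset LinClause)) : Prop :=
  ∃ hne : π ≠ [], (∀ C ∈ π.head hne, ∃ c ∈ φ, C = Clause.toLinClause c) ∧
    List.IsChain RevResLinStep π ∧ (∅ : LinClause) ∈ π.getLast hne

/-! ### The conservation law (strong soundness) -/

/-- The number of clause occurrences on the board falsified by `σ`. [Alekseev–Gaevoy 2026, Def 12]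
[cite: AlekseevGaevoy2026, Def 12] -/
def falsifiedCount (σ : ℕ → Bool) (L : Multiset LinClause) : ℕ :=
  L.countP fun C => C.eval σ = false

/-- Adding one clause to the board adds one to the count iff the clause is falsified. [Alekseev–Gaevoy 2026, Def 12]
[cite: AlekseevGaevoy2026, Def 12] -/
theorem falsifiedCount_cons (σ : ℕ → Bool) (C : LinClause) (L : Multiset LinClause) :
    falsifiedCount σ (C ::ₘ L) = falsifiedCount σ L + if C.eval σ = false then 1 else 0 := by
  unfold falsifiedCount
  rw [Multiset.countP_cons]

/-- The count is additive over the board. [Alekseev–Gaevoy 2026, Def 12] [cite: AlekseevGaevoy2026, Def 12] -/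
theorem falsifiedCount_add (σ : ℕ → Bool) (L K : Multiset LinClause) :
    falsifiedCount σ (L + K) = falsifiedCount σ L + falsifiedCount σ K := by
  unfold falsifiedCount
  rw [Multiset.countP_add]

/-- **Strong soundness of every rule of RevRes(⊕)** [Alekseev–Gaevoy 2026, Defs 12–13, §4.2]: one
step preserves, for every assignment, the number of falsified clause occurrences — including the
degenerate instances `(f, b) ∈ A` of cut/split. [cite: AlekseevGaevoy2026, Def 12, Def 13, §4.2] -/
theorem RevResLinStep.falsifiedCount_eq {L L' : Multiset LinClause} (h : RevResLinStep L L')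
    (σ : ℕ → Bool) : falsifiedCount σ L = falsifiedCount σ L' := by
  have hneg := LinLit.eval_true_eq_not σ
  cases h with
  | cut L A f =>
      simp only [falsifiedCount_cons, LinClause.eval_insert, hneg]
      cases LinClause.eval σ A <;> cases LinLit.eval σ (f, false) <;> simp
  | split L A f =>
      simp only [falsifiedCount_cons, LinClause.eval_insert, hneg]
      cases LinClause.eval σ A <;> cases LinLit.eval σ (f, false) <;> simp
  | emIntro L f =>
      simp [falsifiedCount_cons, LinClause.eval_em]
  | emElim L f =>
      simp [falsifiedCount_cons, LinClause.eval_em]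
  | equiv L A B hAB =>
      simp only [falsifiedCount_cons, hAB σ]

/-- **Conservation along a derivation** [Alekseev–Gaevoy 2026, Remark 19]: every configuration of a
chain of RevRes(⊕) steps has the same number of `σ`-falsified occurrences as the first one.
[cite: AlekseevGaevoy2026, Remark 19] -/
theorem falsifiedCount_eq_of_isChain {π : List (Multiset LinClause)}
    (hπ : List.IsChain RevResLinStep π) (hne : π ≠ []) (σ : ℕ → Bool) :
    ∀ L ∈ π, falsifiedCount σ L = falsifiedCount σ (π.head hne) := by
  refine hπ.induction (fun L => falsifiedCount σ L = falsifiedCount σ (π.head hne)) π ?_ ?_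
  · intro x y hxy hx
    rw [← hx, hxy.falsifiedCount_eq σ]
  · intro _
    rfl

/-- A board of (translated) clauses of `φ` has no occurrence falsified by a satisfying assignment.
[Alekseev–Gaevoy 2026, Remark 19] [cite: AlekseevGaevoy2026, Remark 19] -/
theorem falsifiedCount_eq_zero_of_initial {φ : CNF ℕ} {σ : ℕ → Bool} (hσ : φ.eval σ = true)
    {L : Multiset LinClause} (hL : ∀ C ∈ L, ∃ c ∈ φ, C = Clause.toLinClause c) :
    falsifiedCount σ L = 0 := by
  unfold falsifiedCount
  rw [Multiset.countP_eq_zero]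
  intro C hC
  obtain ⟨c, hc, rfl⟩ := hL C hC
  rw [eval_toLinClause]
  have := (CNF.eval_eq_true_iff φ σ).1 hσ c hc
  simp only [Clause.eval] at this
  simp [this]

/-- **Soundness of RevRes(⊕)** [Alekseev–Gaevoy 2026, Remark 19]: a refuted CNF is unsatisfiable —
a satisfying assignment falsifies no initial occurrence but falsifies the final empty clause,
contradicting conservation. [cite: AlekseevGaevoy2026, Remark 19] -/
theorem not_satisfiable_of_isRevResLinRefutation {φ : CNF ℕ} {π : List (Multiset LinClause)}
    (h : IsRevResLinRefutation φ π) : ¬ φ.Satisfiable := by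
  rintro ⟨σ, hσ⟩
  obtain ⟨hne, hinit, hchain, hlast⟩ := h
  have h0 : falsifiedCount σ (π.head hne) = 0 := falsifiedCount_eq_zero_of_initial hσ hinit
  have hL := falsifiedCount_eq_of_isChain hchain hne σ (π.getLast hne) (List.getLast_mem hne)
  rw [h0] at hL
  obtain ⟨K, hK⟩ := Multiset.exists_cons_of_mem hlast
  rw [hK, falsifiedCount_cons] at hL
  simp at hL

/-! ### Completeness -/

/-- The POINT CLAUSE of the first `k` values of `a`: `⋁_{i<k} (xᵢ = ¬aᵢ)`, false exactly at the
assignments agreeing with `a` below `k`. [folklore] -/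
def pointClause (k : ℕ) (a : ℕ → Bool) : LinClause :=
  (Finset.range k).image fun i => (({i} : Finset ℕ), !a i)

/-- `pointClause 0 a` is the empty clause. [folklore] -/
@[simp] theorem pointClause_zero (a : ℕ → Bool) : pointClause 0 a = ∅ := by
  simp [pointClause]

/-- One more variable: `pointClause (k+1) a = pointClause k a ∨ (x_k = ¬a_k)`. [folklore] -/
theorem pointClause_succ (k : ℕ) (a : ℕ → Bool) :
    pointClause (k + 1) a = insert (({k} : Finset ℕ), !a k) (pointClause k a) := by
  simp [pointClause, Finset.range_add_one, Finset.image_insert]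

/-- The point clause depends only on the first `k` values. [folklore] -/
theorem pointClause_congr {k : ℕ} {a b : ℕ → Bool} (h : ∀ i < k, a i = b i) :
    pointClause k a = pointClause k b := by
  unfold pointClause
  apply Finset.image_congr
  intro i hi
  have := h i (by simpa using hi)
  simp [this]

/-- Semantics of the point clause: it is FALSE under `σ` iff `σ` agrees with `a` below `k`. [folklore] -/
theorem eval_pointClause_eq_false_iff (σ : ℕ → Bool) (k : ℕ) (a : ℕ → Bool) :
    (pointClause k a).eval σ = false ↔ ∀ i < k, σ i = a i := by
  induction k with
  | zero => simp
  | succ k ih =>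
      rw [pointClause_succ, LinClause.eval_insert, Bool.or_eq_false_iff, ih, LinLit.eval_singleton]
      constructor
      · rintro ⟨h1, h2⟩ i hi
        rcases Nat.lt_succ_iff_lt_or_eq.1 hi with hi | rfl
        · exact h2 i hi
        · revert h1
          cases σ i <;> cases a i <;> simp
      · intro h
        refine ⟨?_, fun i hi => h i (Nat.lt_succ_of_lt hi)⟩
        rw [h k (Nat.lt_succ_self k)]
        cases a k <;> simp

/-- SPLITTING PHASE: from a configuration containing `D`, successive splits on `x₀, …, x_{k-1}` along
`a` produce `pointClause k a ∪ D` plus one garbage clause per split (uniformly in the frame `L`).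
[Alekseev–Gaevoy 2026, Def 11 (completeness of blackboard systems)] [cite: AlekseevGaevoy2026, Def 11] -/
theorem reflTransGen_split_pointClause (a : ℕ → Bool) (D : LinClause) :
    ∀ k : ℕ, ∃ G : Multiset LinClause, ∀ L : Multiset LinClause,
      Relation.ReflTransGen RevResLinStep (D ::ₘ L) ((pointClause k a ∪ D) ::ₘ (G + L)) := by
  intro k
  induction k with
  | zero =>
      refine ⟨0, fun L => ?_⟩
      simpa using (Relation.ReflTransGen.refl : Relation.ReflTransGen RevResLinStep (D ::ₘ L) (D ::ₘ L))
  | succ k ih =>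
      obtain ⟨G, hG⟩ := ih
      rw [pointClause_succ]
      cases ha : a k
      · -- keep the copy with `x_k = 1` (= ¬ a k); the copy with `x_k = 0` is garbage
        refine ⟨insert (({k} : Finset ℕ), false) (pointClause k a ∪ D) ::ₘ G, fun L => (hG L).tail ?_⟩
        have hstep := RevResLinStep.split (G + L) (pointClause k a ∪ D) {k}
        rw [Multiset.cons_swap] at hstep
        simpa [Finset.insert_union, Multiset.cons_add] using hstep
      · refine ⟨insert (({k} : Finset ℕ), true) (pointClause k a ∪ D) ::ₘ G, fun L => (hG L).tail ?_⟩
        have hstep := RevResLinStep.split (G + L) (pointClause k a ∪ D) {k}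
        simpa [Finset.insert_union, Multiset.cons_add] using hstep

/-- The translated clause `c ∈ φ`, falsified by `a`, is absorbed by the point clause of `a` on all
`numVars φ` variables: `pointClause V a ∪ C ≡ pointClause V a`. [Alekseev–Gaevoy 2026, Def 11]
[cite: AlekseevGaevoy2026, Def 11] -/
theorem eval_pointClause_union_toLinClause {φ : CNF ℕ} {c : Clause ℕ} (hc : c ∈ φ) {a : ℕ → Bool}
    (ha : Clause.eval a c = false) (σ : ℕ → Bool) :
    (pointClause φ.numVars a ∪ Clause.toLinClause c).eval σ = (pointClause φ.numVars a).eval σ := by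
  rw [LinClause.eval_union]
  cases hP : (pointClause φ.numVars a).eval σ
  · rw [eval_pointClause_eq_false_iff] at hP
    rw [Bool.false_or, eval_toLinClause]
    have key : ∀ l ∈ c, Literal.eval σ l = Literal.eval a l := fun l hl => by
      simp [Literal.eval, hP l.1 (CNF.lt_numVars_of_mem_of_mem hc hl)]
    have : c.any (Literal.eval σ) = c.any (Literal.eval a) := by
      apply Bool.eq_iff_iff.2
      simp only [List.any_eq_true]
      constructor
      · rintro ⟨l, hl, h⟩
        exact ⟨l, hl, by rw [← key l hl]; exact h⟩
      · rintro ⟨l, hl, h⟩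
        exact ⟨l, hl, by rw [key l hl]; exact h⟩
    rw [this]
    simpa [Clause.eval] using ha
  · simp

/-- MERGING PHASE + recursion: for `k + d = numVars φ`, some multiset `I` of translated clauses of the
unsatisfiable `φ` derives (inside any frame `L`) the point clause `pointClause k a` plus garbage —
by splitting a falsified clause when `k = numVars φ`, and otherwise by deriving the two point clauses
one level up and applying one Reversible Cut on `x_k`. [Alekseev–Gaevoy 2026, Def 11]
[cite: AlekseevGaevoy2026, Def 11] -/
theorem exists_reflTransGen_pointClause {φ : CNF ℕ} (hφ : ¬ φ.Satisfiable) :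
    ∀ d k : ℕ, k + d = φ.numVars → ∀ a : ℕ → Bool, ∃ I G : Multiset LinClause,
      (∀ C ∈ I, ∃ c ∈ φ, C = Clause.toLinClause c) ∧
      ∀ L : Multiset LinClause,
        Relation.ReflTransGen RevResLinStep (I + L) (pointClause k a ::ₘ (G + L)) := by
  intro d
  induction d with
  | zero =>
      intro k hk a
      obtain rfl : k = φ.numVars := by simpa using hk
      -- a clause of φ falsified by `a`
      have hfalse : ∃ c ∈ φ, Clause.eval a c = false := by
        by_contra hcon
        refine hφ ⟨a, (CNF.eval_eq_true_iff φ a).2 fun c hc => ?_⟩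
        by_contra hct
        exact hcon ⟨c, hc, by simpa using hct⟩
      obtain ⟨c, hc, hca⟩ := hfalse
      obtain ⟨G, hG⟩ := reflTransGen_split_pointClause a (Clause.toLinClause c) φ.numVars
      refine ⟨{Clause.toLinClause c}, G, ?_, fun L => ?_⟩
      · intro C hC
        rw [Multiset.mem_singleton] at hC
        exact ⟨c, hc, hC⟩
      · rw [Multiset.singleton_add]
        exact (hG L).tail
          (RevResLinStep.equiv _ _ _ (eval_pointClause_union_toLinClause hc hca))
  | succ d ih =>
      intro k hk a
      obtain ⟨I₀, G₀, hI₀, h₀⟩ := ih (k + 1) (by omega) (Function.update a k false)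
      obtain ⟨I₁, G₁, hI₁, h₁⟩ := ih (k + 1) (by omega) (Function.update a k true)
      have hP : ∀ b : Bool, pointClause (k + 1) (Function.update a k b) =
          insert (({k} : Finset ℕ), !b) (pointClause k a) := by
        intro b
        rw [pointClause_succ, Function.update_self]
        congr 1
        exact pointClause_congr fun i hi => Function.update_of_ne (Nat.ne_of_lt hi) _ _
      rw [hP] at h₀ h₁
      refine ⟨I₀ + I₁, G₀ + G₁, ?_, fun L => ?_⟩
      · intro C hC
        rcases Multiset.mem_add.1 hC with hC | hC
        · exact hI₀ C hC
        · exact hI₁ C hC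
      · have e₀ : I₀ + I₁ + L = I₀ + (I₁ + L) := add_assoc _ _ _
        have e₁ : insert (({k} : Finset ℕ), !false) (pointClause k a) ::ₘ (G₀ + (I₁ + L)) =
            I₁ + (insert (({k} : Finset ℕ), true) (pointClause k a) ::ₘ (G₀ + L)) := by
          simp only [Bool.not_false, ← Multiset.singleton_add]
          abel
        have e₂ : insert (({k} : Finset ℕ), !true) (pointClause k a) ::ₘ
              (G₁ + (insert (({k} : Finset ℕ), true) (pointClause k a) ::ₘ (G₀ + L))) =
            insert (({k} : Finset ℕ), false) (pointClause k a) ::ₘ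
              insert (({k} : Finset ℕ), true) (pointClause k a) ::ₘ (G₀ + G₁ + L) := by
          simp only [Bool.not_true, ← Multiset.singleton_add]
          abel
        rw [e₀]
        refine ((h₀ (I₁ + L)).trans ?_).tail (RevResLinStep.cut (G₀ + G₁ + L) (pointClause k a) {k})
        rw [e₁, ← e₂]
        exact h₁ _

/-- **Completeness of RevRes(⊕)** [Alekseev–Gaevoy 2026, Def 11 — RevRes(⊕) is a blackboard proof
system]: every unsatisfiable CNF has a RevRes(⊕) refutation (of length `2^{O(numVars)}·|φ|`: split one
falsified clause per assignment into its point clause, then merge all point clauses by cuts).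
[cite: AlekseevGaevoy2026, Def 11, §4.2] -/
theorem exists_isRevResLinRefutation {φ : CNF ℕ} (hφ : ¬ φ.Satisfiable) :
    ∃ π : List (Multiset LinClause), IsRevResLinRefutation φ π := by
  obtain ⟨I, G, hI, h⟩ :=
    exists_reflTransGen_pointClause hφ φ.numVars 0 (by simp) fun _ => false
  have h0 := h 0
  simp only [add_zero, pointClause_zero] at h0
  obtain ⟨l, hchain, hlast⟩ := List.exists_isChain_cons_of_relationReflTransGen h0
  refine ⟨I :: l, List.cons_ne_nil _ _, ?_, hchain, ?_⟩
  · simpa using hI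
  · rw [hlast]
    exact Multiset.mem_cons_self _ _

/-! ### Depth-stamped derivations -/

/-- One step of a DEPTH-STAMPED RevRes(⊕) derivation: the same five rules acting on configurations of
stamped clause occurrences `(C, d)`, where the stamp of a conclusion is one more than the largest
stamp of a premise (`emIntro` conclusions are stamped `0`, equivalence keeps the stamp). The stamp of
an occurrence is the length of the longest chain of rule applications below it, i.e. its depth in
the parity DAG of the derivation — the blackboard reading of [Alekseev–Gaevoy, ECCC TR26-007,
Defs 2.2–2.3] (cf. `resLinDepth` for line-based Res(⊕)). [cite: AlekseevGaevoy2026b, Def 2.2, Def 2.3] -/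
inductive RevResLinDStep : Multiset (LinClause × ℕ) → Multiset (LinClause × ℕ) → Prop
  /-- Reversible Cut, conclusion stamped `max d₀ d₁ + 1`. -/
  | cut (L : Multiset (LinClause × ℕ)) (A : LinClause) (f : Finset ℕ) (d₀ d₁ : ℕ) :
      RevResLinDStep ((insert (f, false) A, d₀) ::ₘ (insert (f, true) A, d₁) ::ₘ L)
        ((A, max d₀ d₁ + 1) ::ₘ L)
  /-- Split, both conclusions stamped `d + 1`. -/
  | split (L : Multiset (LinClause × ℕ)) (A : LinClause) (f : Finset ℕ) (d : ℕ) :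
      RevResLinDStep ((A, d) ::ₘ L) ((insert (f, false) A, d + 1) ::ₘ (insert (f, true) A, d + 1) ::ₘ L)
  /-- Excluded Middle, stamped `0` (no premise). -/
  | emIntro (L : Multiset (LinClause × ℕ)) (f : Finset ℕ) :
      RevResLinDStep L ((({(f, false), (f, true)} : LinClause), 0) ::ₘ L)
  /-- Reversed Excluded Middle (any stamp). -/
  | emElim (L : Multiset (LinClause × ℕ)) (f : Finset ℕ) (d : ℕ) :
      RevResLinDStep ((({(f, false), (f, true)} : LinClause), d) ::ₘ L) L
  /-- Reversible Equivalence keeps the stamp (same node of the parity DAG). -/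
  | equiv (L : Multiset (LinClause × ℕ)) (A B : LinClause) (d : ℕ)
      (h : ∀ σ : ℕ → Bool, A.eval σ = B.eval σ) :
      RevResLinDStep ((A, d) ::ₘ L) ((B, d) ::ₘ L)

/-- A depth-stamped RevRes(⊕) refutation of `φ`: initial occurrences are translated clauses of `φ`
stamped `0`, consecutive configurations are related by one stamped step, the last configuration
contains an occurrence of the empty clause. [Alekseev–Gaevoy, ECCC TR26-007, Defs 2.2–2.3; ITCS 2026, Def 9]
[cite: AlekseevGaevoy2026b, Def 2.2, Def 2.3] -/
def IsRevResLinDRefutation (φ : CNF ℕ) (π : List (Multiset (LinClause × ℕ))) : Prop :=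
  ∃ hne : π ≠ [], (∀ x ∈ π.head hne, x.2 = 0 ∧ ∃ c ∈ φ, x.1 = Clause.toLinClause c) ∧
    List.IsChain RevResLinDStep π ∧ ∃ d : ℕ, ((∅ : LinClause), d) ∈ π.getLast hne

/-- The DEPTH of a stamped derivation: the largest stamp of an occurrence in any configuration.
[Alekseev–Gaevoy, ECCC TR26-007, Def 2.3] [cite: AlekseevGaevoy2026b, Def 2.3] -/
def revResLinDDepth (π : List (Multiset (LinClause × ℕ))) : ℕ :=
  (π.map fun L => (L.map Prod.snd).sup).foldr max 0

/-- Forgetting stamps maps a stamped step to a plain RevRes(⊕) step. [Alekseev–Gaevoy 2026, §4.2]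
[cite: AlekseevGaevoy2026, §4.2] -/
theorem RevResLinDStep.map_fst : ∀ {L L' : Multiset (LinClause × ℕ)}, RevResLinDStep L L' →
    RevResLinStep (L.map Prod.fst) (L'.map Prod.fst)
  | _, _, .cut L A f _ _ => by simpa using RevResLinStep.cut (L.map Prod.fst) A f
  | _, _, .split L A f _ => by simpa using RevResLinStep.split (L.map Prod.fst) A f
  | _, _, .emIntro L f => by simpa using RevResLinStep.emIntro (L.map Prod.fst) f
  | _, _, .emElim L f _ => by simpa using RevResLinStep.emElim (L.map Prod.fst) f
  | _, _, .equiv L A B _ hAB => by simpa using RevResLinStep.equiv (L.map Prod.fst) A B hAB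

/-- Forgetting stamps maps a stamped refutation to a plain RevRes(⊕) refutation with the same
length. [Alekseev–Gaevoy 2026, §4.2; ECCC TR26-007, Def 2.3] [cite: AlekseevGaevoy2026, §4.2] -/
theorem IsRevResLinDRefutation.map_fst {φ : CNF ℕ} {π : List (Multiset (LinClause × ℕ))}
    (h : IsRevResLinDRefutation φ π) :
    IsRevResLinRefutation φ (π.map (Multiset.map Prod.fst)) ∧
      (π.map (Multiset.map Prod.fst)).length = π.length := by
  obtain ⟨hne, hinit, hchain, d, hlast⟩ := h
  have hne' : π.map (Multiset.map Prod.fst) ≠ [] := by simpa using hne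
  refine ⟨⟨hne', ?_, ?_, ?_⟩, List.length_map _⟩
  · intro C hC
    rw [List.head_map, Multiset.mem_map] at hC
    obtain ⟨x, hx, rfl⟩ := hC
    exact (hinit x hx).2
  · exact List.isChain_map_of_isChain (Multiset.map Prod.fst) (fun _ _ h => h.map_fst) hchain
  · rw [List.getLast_map, Multiset.mem_map]
    exact ⟨(∅, d), hlast, rfl⟩

/-! ### The PHP transfer (Alekseev–Gaevoy's intersection theorem, PHP corollary) -/

/-- **Res(⊕) refutations of the pigeonhole principle transfer to RevRes(⊕) with polynomial loss**
(named fact, established in print): there is an exponent `q` such that every Res(⊕) refutation of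
`PHP^{n+1}_n` with `s` lines yields a RevRes(⊕) refutation of LENGTH at most `(s + n + 2)^q`.
This is [Alekseev–Gaevoy 2026, Thm 26] (`Res(⊕) ⋏ u-wRes(⊕)` is p-equivalent to `RevRes(⊕)`, an
instance of the intersection theorem Thm 21, which preserves both size and length, Remark 10)
combined with the polynomial-size `u-wRes(⊕) ⊇ u-wRes ≡ uSA` refutations of `PHP^{n+1}_n` — exactly
the proof of their Cor 27, whose printed statement has the two systems interchanged (a typo: as
printed, "RevRes(⊕) size S ⇒ Res(⊕) size poly(S,n)" is trivial since Res(⊕) ⊇ RevRes(⊕); the text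
"reduce PHP lower bounds in Res(⊕) to PHP lower bounds in RevRes(⊕)", abstract and §1, is the
direction recorded here). Translation notes: our Res(⊕) (`IsResLinRefutation`, Itsykson–Sokolov) has
syntactic resolution + SEMANTIC weakening; a semantic weakening `C ⊨ D` of linear clauses is
simulated in AG's Res(⊕) by `≤ width` splits, copies and one equivalence, so line counts agree up to
a factor `poly(n)`; the additive `n + 2` absorbs `s ≤ 1` and `n ≤ 1`.
OPEN (their Question 3, §1 p. 3, NOT asserted anywhere in this file): is the length of RevRes(⊕)
refutations of `PHP^{n+1}_n` superpolynomial in `n`?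
[cite: AlekseevGaevoy2026, Thm 26, Cor 27, Remark 10] -/
def exists_isRevResLinRefutation_php_of_isResLinRefutation : Prop :=
  ∃ q : ℕ, ∀ (n : ℕ) (π : List ResLinLine), IsResLinRefutation (pigeonholeCNF (n + 1) n) π →
    ∃ π' : List (Multiset LinClause), IsRevResLinRefutation (pigeonholeCNF (n + 1) n) π' ∧
      π'.length ≤ (π.length + n + 2) ^ q

end Literature.Computability.MetaComplexity
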